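import Literature.AlgebraicGeometry.Resolution.QuadraticSequenceDimOneExistence
import Mathlib.RingTheory.Valuation.LocalSubring
import HarnessLib

/-!
# HIO data for a given valuation subring

Adaptation of `exists_valuationSubring_dominates_of_finite_integralClosure` from
Literature/AlgebraicGeometry/Resolution/QuadraticSequenceDimOneExistence.lean
for a GIVEN valuation subring `O` dominating `A`, rather than constructing one.

Route (lead g7 18:55Z): N := integralClosure (as Subring), Q := 𝔪_O ∩ N.
O ⊇ N_Q a DVR ⇒ O = N_Q by ValuationSubring.primeSpectrumOrderEquiv
(a DVR has exactly two overrings: itself and the field).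
-/

noncomputable section

namespace Literature.AlgebraicGeometry.Resolution

universe u

variable {L : Type u} [Field L]

open IsLocalRing Literature.RingTheory.DiscreteValuationRing

/-- An element integral over A ⊆ O lies in O (O is integrally closed). [folklore] -/
private theorem mem_valuationSubring_of_isIntegral_aux {A : Subring L} {O : ValuationSubring L}
    (hAO : A ≤ O.toSubring) {c : L} (hc : IsIntegral A c) : c ∈ O.toSubring := by
  -- c is integral over A, so integral over O (since A ⊆ O)
  obtain ⟨p, hpm, hpe⟩ := hc
  have hcO : IsIntegral O.toSubring c := by
    refine ⟨p.map (Subring.inclusion hAO), ?_, ?_⟩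
    · exact hpm.map _
    · simp only [Polynomial.eval₂_map]
      convert hpe using 1
      rfl
  have hcO' : IsIntegral O.toLocalSubring.toSubring c := hcO
  exact LocalSubring.mem_of_isMax_of_isIntegral O.isMax_toLocalSubring hcO'

/-- **HIO data for a given valuation subring**: Let `A ⊆ L` be a one-dimensional Noetherian local
domain with fraction field `L`, not a field, whose integral closure `N` in `L` is a finite
`A`-module. If `O` is a valuation ring of `L` dominating `A` and `O ≠ ⊤`, then:
* `O` is a discrete valuation ring (= `N_Q` where `Q = 𝔪_O ∩ N` is maximal in the Dedekind domain `N`);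
* `N ⊆ O` is generated over `A` by a finite set;
* `O ⊆ N_{𝔪_O ∩ N}` (= `O` by the DVR characterization).

This adapts `exists_valuationSubring_dominates_of_finite_integralClosure` for a GIVEN `O`.
[cite: HerrmannIkedaOrbanz1988, Thm. (30.2) (proof)] -/
theorem hio_data_of_valuationSubring
    {A : Subring L} [IsNoetherianRing A] [Ring.KrullDimLE 1 A]
    (hof : IsLocalRingOf A) (hA : ¬ IsField A)
    (hfin : Module.Finite A (integralClosure A L))
    (O : ValuationSubring L) (hO : SubringDominates A O.toSubring) (hOtop : O ≠ ⊤) :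
    IsDiscreteValuationRing O ∧
      ∃ (N : Subring L) (S : Finset L),
        N ≤ O.toSubring ∧
        (S : Set L) ⊆ N ∧
        N ≤ Subring.closure ((A : Set L) ∪ ↑S) ∧
        O.toSubring ≤ locAtCentre N O := by
  classical
  haveI : IsLocalRing A := hof.1
  haveI : IsFractionRing A L := isFractionRing_of_isLocalRingOf_le hof.2 le_rfl
  haveI : Ring.DimensionLEOne A := dimensionLEOne_subring
  haveI : IsDedekindDomain (integralClosure A L) :=
    KrullAkizuki_holds.isDedekindDomain_integralClosure hA L L
  have hinj : Function.Injective (algebraMap A (integralClosure A L)) := fun x y hxy =>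
    Subtype.ext (congrArg (fun c : integralClosure A L => (c : L)) hxy)

  -- The integral closure N ≤ O (since O is integrally closed and dominates A)
  have hNO : (integralClosure A L).toSubring ≤ O.toSubring := fun c hc =>
    mem_valuationSubring_of_isIntegral_aux hO.1 (show IsIntegral A c from hc)

  -- The centre Q := 𝔪_O ∩ N is a prime ideal of N
  let Q : Ideal (integralClosure A L) :=
    (maximalIdeal O).comap (Subring.inclusion hNO)

  -- Q lies over 𝔪_A
  have hQover : Q.comap (algebraMap A (integralClosure A L)) = maximalIdeal A := by
    ext a
    simp only [Ideal.mem_comap]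
    constructor
    · intro hQ
      -- a ∈ Q means a ∈ 𝔪_O, so a is not a unit in O
      have haO : (a : L) ∈ O.toSubring := hO.1 a.2
      have haM : (⟨(a : L), haO⟩ : O) ∈ maximalIdeal O := hQ
      rw [mem_maximalIdeal, mem_nonunits_iff] at haM
      -- if a were a unit in A, then a⁻¹ ∈ A, so a⁻¹ ∈ O, so a is a unit in O
      rw [mem_maximalIdeal, mem_nonunits_iff]
      intro hu
      have ha0 : (a : L) ≠ 0 := by
        intro h
        have : a = 0 := Subtype.ext h
        rw [this] at hu
        exact not_isUnit_zero hu
      have hainv : (a : L)⁻¹ ∈ A := ((isUnit_subring_iff_inv_mem _).mp hu).2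
      have hainvO : (a : L)⁻¹ ∈ O.toSubring := hO.1 hainv
      have huO : IsUnit (⟨(a : L), haO⟩ : O) := by
        rw [isUnit_iff_exists_inv]
        exact ⟨⟨(a : L)⁻¹, hainvO⟩, Subtype.ext (mul_inv_cancel₀ ha0)⟩
      exact haM huO
    · intro ha
      rw [mem_maximalIdeal] at ha
      -- a ∈ 𝔪_A means a is not a unit in A
      -- if a were a unit in O, then a⁻¹ ∈ O; by domination a⁻¹ ∈ A, so a is a unit in A
      have haO : (a : L) ∈ O.toSubring := hO.1 a.2
      by_contra h
      -- h : algebraMap A (integralClosure A L) a ∉ Q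
      -- show this leads to contradiction with ha
      have haM : (⟨(a : L), haO⟩ : O) ∉ maximalIdeal O := by
        intro hcontra
        exact h hcontra
      rw [mem_maximalIdeal, mem_nonunits_iff, not_not] at haM
      obtain ⟨u, hu⟩ := isUnit_iff_exists_inv.mp haM
      have hainvO : (a : L)⁻¹ ∈ O.toSubring := by
        have heq : (↑u : L) = (a : L)⁻¹ := by
          have hmul := congrArg Subtype.val hu
          change (⟨(a : L), haO⟩ : O).1 * u.1 = 1 at hmul
          rw [mul_comm] at hmul
          exact eq_inv_of_mul_eq_one_left hmul
        rw [← heq]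
        exact u.2
      by_cases ha0 : (a : L) = 0
      · -- a = 0 means 0 is a unit of O (via haM), contradiction since O is nontrivial
        have hmul := congrArg Subtype.val hu
        change (⟨(a : L), haO⟩ : O).1 * u.1 = 1 at hmul
        simp only [ha0, zero_mul] at hmul
        exact one_ne_zero hmul.symm
      · have hainvA : (a : L)⁻¹ ∈ A := hO.2 a a.2 hainvO
        have huA : IsUnit a := (isUnit_subring_iff_inv_mem _).mpr ⟨ha0, hainvA⟩
        exact ha huA

  -- Q ≠ ⊥ because A is not a field
  have hQne : Q ≠ ⊥ := by
    intro hQ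
    apply hA
    rw [IsLocalRing.isField_iff_maximalIdeal_eq, eq_bot_iff]
    intro a ha
    have hmem : algebraMap A (integralClosure A L) a ∈ Q := by
      rw [← hQover] at ha
      exact ha
    rw [hQ] at hmem
    simp only [Ideal.mem_bot] at hmem
    have : (a : L) = 0 := congrArg Subtype.val hmem
    exact Subtype.ext this

  haveI hQprime : Q.IsPrime := (maximalIdeal.isMaximal O).isPrime.comap _

  -- Q is maximal in N (one-dimensional Dedekind domain, nonzero prime)
  haveI : Ring.DimensionLEOne (integralClosure A L) := inferInstance
  have hQmax : Q.IsMaximal := Ideal.IsPrime.isMaximal hQprime hQne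

  -- The localization N_Q ⊆ L is a DVR
  let 𝒪 : Subalgebra (integralClosure A L) L :=
    Localization.subalgebra.ofField L Q.primeCompl Q.primeCompl_le_nonZeroDivisors
  haveI : IsLocalization.AtPrime 𝒪 Q := Localization.subalgebra.isLocalization_ofField L _ _
  haveI hDVR : IsDiscreteValuationRing 𝒪 :=
    IsLocalization.AtPrime.isDiscreteValuationRing_of_dedekind_domain _ hQne 𝒪

  -- 𝒪 ≤ O (N ≤ O and denominators t ∉ Q means t ∉ 𝔪_O, so t is a unit of O)
  have h𝒪O : 𝒪.toSubring ≤ O.toSubring := by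
    rintro z ⟨a, t, ht, rfl⟩
    have haO : (a : L) ∈ O.toSubring := hNO a.2
    have htO : (t : L) ∈ O.toSubring := hNO t.2
    -- t ∉ Q means t ∉ 𝔪_O (since Q = 𝔪_O ∩ N), so t is a unit of O
    have htunit : IsUnit (⟨(t : L), htO⟩ : O) := by
      rw [isUnit_iff_exists_inv]
      have htnQ : t ∉ Q := ht
      -- Q = 𝔪_O ∩ N, so t ∉ Q means t is a unit of O
      have htnM : (⟨(t : L), htO⟩ : O) ∉ maximalIdeal O := htnQ
      rw [mem_maximalIdeal, mem_nonunits_iff, not_not] at htnM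
      obtain ⟨u, hu⟩ := isUnit_iff_exists_inv.mp htnM
      exact ⟨u, hu⟩
    obtain ⟨u, hu⟩ := isUnit_iff_exists_inv.mp htunit
    have hinv : (t : L)⁻¹ ∈ O.toSubring := by
      have : (↑u : L) = (t : L)⁻¹ := by
        have hmul := congrArg Subtype.val hu
        change (⟨(t : L), htO⟩ : O).1 * u.1 = 1 at hmul
        rw [mul_comm] at hmul
        exact eq_inv_of_mul_eq_one_left hmul
      rw [← this]
      exact u.2
    show (a : L) * ((t : L))⁻¹ ∈ O.toSubring
    exact O.toSubring.mul_mem haO hinv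

  -- O ≤ 𝒪: A DVR has exactly two overrings (itself and the field), by primeSpectrumOrderEquiv
  -- Since 𝒪 ≤ O ≤ L and O ≠ L (i.e. O ≠ ⊤), we have O = 𝒪
  have hO𝒪 : O.toSubring ≤ 𝒪.toSubring := by
    -- 𝒪 is a DVR, hence a valuation ring, so we can build a ValuationSubring from it
    have hmem_or : ∀ z : L, z ∈ 𝒪 ∨ z⁻¹ ∈ 𝒪 := by
      intro z
      rcases ValuationRing.isInteger_or_isInteger 𝒪 z with ⟨y, hy⟩ | ⟨y, hy⟩
      · exact Or.inl (hy ▸ y.2)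
      · exact Or.inr (hy ▸ y.2)
    let 𝒪' : ValuationSubring L :=
      { 𝒪.toSubring with
        mem_or_inv_mem' := hmem_or }
    -- 𝒪' ≤ O since 𝒪.toSubring ≤ O.toSubring
    have h𝒪'O : 𝒪' ≤ O := h𝒪O
    -- 𝒪' is a DVR, so Ring.KrullDimLE 1 𝒪'
    haveI : IsDiscreteValuationRing 𝒪' :=
      IsDiscreteValuationRing.RingEquivClass.isDiscreteValuationRing (A := 𝒪) (B := 𝒪')
        ({ toFun := fun x => ⟨x.1, x.2⟩, invFun := fun x => ⟨x.1, x.2⟩, left_inv := fun _ => rfl,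
           right_inv := fun _ => rfl, map_mul' := fun _ _ => rfl, map_add' := fun _ _ => rfl } :
          𝒪 ≃+* 𝒪')
    haveI : Ring.KrullDimLE 1 𝒪' := inferInstance
    -- By eq_self_or_eq_top_of_le: either 𝒪' = O or O = ⊤
    rcases ValuationSubring.eq_self_or_eq_top_of_le h𝒪'O with h | h
    · -- 𝒪' = O, so O.toSubring = 𝒪'.toSubring = 𝒪.toSubring
      intro z hz
      have : z ∈ 𝒪'.toSubring := h ▸ hz
      exact this
    · -- O = ⊤, contradiction with hOtop
      exact absurd h hOtop

  -- Hence O = 𝒪 as subrings, and O is a DVR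
  have hOeq : O.toSubring = 𝒪.toSubring := le_antisymm hO𝒪 h𝒪O

  have hdvr : IsDiscreteValuationRing O := by
    have heq : 𝒪 ≃+* O :=
      { toFun := fun x => ⟨x.1, h𝒪O x.2⟩
        invFun := fun x => ⟨x.1, hO𝒪 x.2⟩
        left_inv := fun _ => rfl
        right_inv := fun _ => rfl
        map_mul' := fun _ _ => rfl
        map_add' := fun _ _ => rfl }
    exact IsDiscreteValuationRing.RingEquivClass.isDiscreteValuationRing heq

  -- Generators of N over A
  obtain ⟨s, hs⟩ := Module.Finite.fg_top (R := A) (M := integralClosure A L)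

  refine ⟨hdvr, (integralClosure A L).toSubring,
    s.image (fun c : integralClosure A L => (c : L)), hNO, ?_, ?_, ?_⟩
  · -- S ⊆ N
    intro x hx
    rw [Finset.coe_image] at hx
    obtain ⟨c, -, rfl⟩ := hx
    exact c.2
  · -- N ⊆ A[S]
    have key : ∀ x ∈ Submodule.span A (s : Set (integralClosure A L)),
        (x : L) ∈ Subring.closure ((A : Set L) ∪ ↑(s.image fun c : integralClosure A L => (c : L))) := by
      intro x hx
      induction hx using Submodule.span_induction with
      | mem x hx =>
        refine Subring.subset_closure (Or.inr ?_)
        rw [Finset.coe_image]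
        exact ⟨x, hx, rfl⟩
      | zero => exact Subring.zero_mem _
      | add x y _ _ hx hy => exact Subring.add_mem _ hx hy
      | smul a x _ hx =>
        change ((a : L) * (x : L)) ∈ _
        exact Subring.mul_mem _ (Subring.subset_closure (Or.inl a.2)) hx
    intro c hc
    have hcmem : (⟨c, hc⟩ : integralClosure A L) ∈ Submodule.span A (s : Set (integralClosure A L)) := by
      rw [hs]; exact Submodule.mem_top
    exact key _ hcmem
  · -- O ⊆ N_{𝔪_O ∩ N}
    intro z hz
    -- z ∈ O = 𝒪 = N_Q, so z = a/t with a ∈ N, t ∉ Q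
    have hz' : z ∈ 𝒪.toSubring := hO𝒪 hz
    obtain ⟨a, t, ht, rfl⟩ := hz'
    refine ⟨(a : L), a.2, (t : L), t.2, ?_, by rw [div_eq_mul_inv]; rfl⟩
    -- t ∉ Q means t is a unit of O = 𝒪, so O.valuation t = 1
    have htO : (t : L) ∈ O.toSubring := hNO t.2
    have htunit : IsUnit (⟨(t : L), htO⟩ : O) := by
      rw [isUnit_iff_exists_inv]
      have htnQ : t ∉ Q := ht
      have htnM : (⟨(t : L), htO⟩ : O) ∉ maximalIdeal O := htnQ
      rw [mem_maximalIdeal, mem_nonunits_iff, not_not] at htnM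
      obtain ⟨u, hu⟩ := isUnit_iff_exists_inv.mp htnM
      exact ⟨u, hu⟩
    exact (O.valuation_eq_one_iff _).mp htunit

end Literature.AlgebraicGeometry.Resolution
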